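import Mathlib
import HarnessLib
import HarnessLib.Audit
import Summits.HubbardSuperconductivity.Statement
import Literature.MathematicalPhysics.QuantumLattice.XYOrder
import Literature.Barriers.HubbardSuperconductivity.PureModelStripeCompetition
import HarnessLib.Audit.Status.Attr

/-!
Route: AbelianDuality

DORMANT since 2026-08-26T12:05:08Z (reconciler: no traction for 8.2 d (last activity item-evidence-added at 2026-08-18T06:56:25Z); parked, not closed — `ledger route dormant route-HubbardSuperconductivity-AbelianDuality --off` to reacti) — unstaffed, not closed; items shared with open routes are served there. `ledger route dormant <id> --off` reactivates.

# Route AbelianDuality — HubbardSuperconductivity (idea card abelian-duality-vortex-peierls;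
plancard planner 2026-08-15)

## Thesis X (it suffices to show)
GROUND-STATE-AVERAGE d-wave pair LRO on an open coupling window: there are a doping δ ∈ (0,1/2), a
window
0 < U₁ < U₂, c > 0 and L₀ such that for every U ∈ (U₁,U₂) and every EVEN L ≥ L₀ the tracial
ground-state functional
ω₀^{sec}_{U,L} of `hubbardTorus 2 L 1 U` COMPRESSED to the (N_L, S^z = 0) coordinate sector
(occupation sets s with
|s| = N_L = 2⌊(1-δ)L²/2⌋ and #↑ = #↓; `Matrix.toBlock p p`, `Matrix.groundStateFunctional`)
satisfies
c·L⁴ ≤ Re ω₀^{sec}(Δ_d† Δ_d), Δ_d = pairField dWaveFormFactor L. (Decl `Thesis`.)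
Assembly: X → AverageToEvery → HubbardSuperconductivity is pure logic (checked: a 4-line term proof
elaborates), where
AverageToEvery (crux, shared with the every-ground-state cards) upgrades sector-AVERAGE LRO on a
U-window to the summit
matrix `HasDWavePairFieldLROAt U δ` at SOME U of the window (room to discard non-generic U with
accidental degeneracy).

Lean (one line, elaborated rc=0 in the planner's Sketch.lean together with all items below):
∃ δ ∈ Set.Ioo (0:ℝ) (1/2), ∃ U₁ U₂ : ℝ, 0 < U₁ ∧ U₁ < U₂ ∧ ∃ c : ℝ, 0 < c ∧ ∃ L₀ : ℕ, ∀ U ∈ Set.Ioo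
U₁ U₂, ∀ (L : ℕ) [NeZero L], L₀ ≤ L → Even L → let p : Finset (Orb (FermionTorus 2 L)) → Prop := fun
s => s.card = 2 * ⌊(1 - δ) * (L : ℝ) ^ 2 / 2⌋₊ ∧ 2 * (s.filter fun i => (ofLex i).2 = 0).card = 2 *
⌊(1 - δ) * (L : ℝ) ^ 2 / 2⌋₊; c * (L : ℝ) ^ 4 ≤ (((hubbardTorus 2 L 1 U).toBlock p
p).groundStateFunctional (((pairField dWaveFormFactor L)ᴴ * pairField dWaveFormFactor L).toBlock p
p)).re

## Why X (the mechanism of the card): the ABELIAN ADVANTAGE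
Superconducting order is U(1). Abelian lattice models own an order-forcing engine other than
reflection positivity:
exact integer duality (closed pair-current world lines ↔ integer height/gauge field ↔ vortex defect
loops) followed by an
energy–entropy (Peierls) bound on the dual defects [Guth1980, FrohlichSpencerCMP1982,
FrohlichSpencerKT1981]. Every
trace-based engine of this kind (imaginary-time world lines at β → ∞ on a finite torus) computes
exactly the sector
ground-state AVERAGE — hence X is the honest hub: the T = 0 line (reduction to a positive-weight
(2+1)D current model in
the dilute-vortex class + Peierls on vortex loops ⇒ X) and the T > 0 companion (BKT power-law LOWER
bound saturating
Koma–Tasaki, uniform in L and β ≥ β₀ ⇒ X by β → ∞ at fixed L, support item ThermalToGroundAverage,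
elementary from the
PROVED cone fact `tendsto_gibbsState_atTop_holds`) both land on X, and the every-ground-state clause
of the summit is
isolated in one crux. No reflection positivity anywhere: no half filling, no bipartiteness, no Shiba
map.

Rationale: WHY THIS LINE (catalogue: duality / physical analogy WITH an explicit dictionary; probabilistic
model). Continuous-symmetry
ground-state LRO in d = 2 has only ever been proved by reflection positivity (Tasaki2019Tower §3.2;
KLS1988PRL), which for
itinerant fermions forces half filling (route ShibaRP pays with the Shiba map). The pair condensate
is ABELIAN, and abelian
models have a second engine: integer duality + Peierls on dual defects (Guth1980 4D U(1);
FrohlichSpencerCMP1982 massless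
phases; FrohlichSpencerKT1981 BKT). Dictionary (checkable): pair phase ↦ XY angle, pair current ↦
J-current (WallinEtAl1994),
vortex ↦ dual defect line, phase stiffness ↦ Villain β, pair density ↦ dual background flux 2πν
(FisherLee1989). Imported:
classical abelian lattice gauge/spin duality and defect energy–entropy expansions (stat. mech. /
constructive QFT); BKT
height-function delocalisation (arXiv:2110.09498) for the T > 0 companion; the tree's PROVED Gibbs →
ground-state limit.

RANKED CRUXES
2 PairCurrentRepresentation [informal; needs_definition PositiveCurrentModel — filed]: at some δ and
U-window the sector Gibbs
  d-wave pair two-point function dominates from below that of a (2+1)D U(1) closed-current model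
with NON-NEGATIVE dual-positive
  local weights, stiffness ≥ ρ₀, vortex fugacity ≤ z₀(ρ₀), uniformly in L, β. Hardest: fermion
signs, nodal quasiparticles,
  frustration (pair density non-integer ⇒ dual Berry phases unless δ commensurate/gaugeable). The
class theorem of the engine
  (dilute-vortex positive current models order, RP-free) is filed as a typed crux when the
definition lands.
3 LargeSpinKingXYLRO [typed]: GS LRO for the integer-spin (S = n/2, n even ≥ n₀) XY FERROMAGNET with
nearest + next-nearest
  (ℓ∞-distance-1) couplings on (ℤ/Lℤ)², all L ≥ L₀ — the engine's first client: unfrustrated dual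
(integer currents, m ↦ -m
  symmetry), large parameter S, and RP-INACCESSIBLE (NNN bonds; BenassiLeesUeltschi2016 inequalities
are monotone in same-
  component couplings only, so it is not KLS + Griffiths). A proof is the first RP-free
continuous-symmetry GS LRO in 2D.
4 SectorDWaveBKTBound [typed]: T > 0 companion — c (dist+1)^(-C/β) ≤ Re⟨P_x†P_y⟩ in the sector Gibbs
state for dist ≥ R₀,
  all β ≥ β₀, even L ≥ L₀, U in a window: SATURATES koma_tasaki_2d (proved in the tree; exponent ∝
1/β).
5 AverageToEvery [typed]: sector-average LRO on a U-window ⇒ HasDWavePairFieldLROAt at some U in it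
(generic-U Schur /
  multiplicity-free sector ground spaces; shared with cards generic-u-schur-every-gs,
positivity-pins-characters).
Support 9 ThermalToGroundAverage [typed, provable now]: SectorDWaveBKTBound → Thesis (β → ∞ at fixed
L via
  tendsto_gibbsState_atTop_holds, a-priori ‖P_x†P_y‖ ≤ 32 on the dist < R₀ shell). Assembly 1:
Thesis → AverageToEvery → summit.

KILL CRITERIA. (i) Fastest refutation of the card: the exact dual of the time-discretised world-line
model of integer-filling
soft-core bosons / integer-spin XY carries irreducible complex weights ⇒ engine dead at every
density ⇒ close. (ii) A proof that
NO positive pair-current domination can hold for Hubbard at any (U,δ) (sign structure theorem) ⇒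
close the T = 0 line; route
survives only on crux 4. (iii) AverageToEvery refuted ⇒ restate with an explicit genericity
hypothesis (not a kill).
(iv) LargeSpinKingXYLRO proved BY RP or inequalities after all ⇒ milestone uninformative, replace by
odd-L / rotor version.

DELIBERATELY NOT DECOMPOSED: the reduction itself (which window: weak-coupling KL/chiral d+id window
of card chiral-window-d-plus-id
first; commensurate δ), the abstract class theorem (awaits PositiveCurrentModel), the quantum-XY BKT
lower bound at large S
(T > 0 engine milestone one dimension down), vortex-core/stiffness (Byers–Yang flux) flanks, and any
link to WeakCouplingBCS #4.
NOVELTY / BARRIERS: see the route's Novelty and Barriers fields (searches run 2026-08-15 listed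
there).

Novelty: Nearest prior art (searched 2026-08-15 by this planner: `lit search --hybrid "long range order
ground state quantum XY model without reflection positivity"` → FriedliVelenik2017,
book:liebnd-statistical-mechanics, book:lieb2005-mathematics-bose-gas-its-condensation pp.117-118
(BEC of lattice bosons beyond half filling open); `lit search --source crossref "Correlation
inequalities for the quantum XY model"` → doi:10.1007/s10955-016-1580-2 = BenassiLeesUeltschi2016
(read arXiv:1510.03215 pp.2-4: Cor. 2 monotone INCREASING in same-component couplings, DECREASING in
the other component; S=1 only in the ground state — so isotropic NNN bonds are not covered and crux
LargeSpinKingXYLRO is not KLS1988PRL + inequalities); `lit galaxy search "Massless phases and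
symmetry restoration" --star all` (Montvay–Münster, Malyshev–Minlos only); `lit frontier
HubbardSuperconductivity --since 2020`, `lit bridges HubbardSuperconductivity --cross any` (bridges
run through FriedliVelenik2017 into the O(2)/loop/height-function literature, arXiv:1708.00058 — the
BKT technology, never pointed at this summit); plus the card's own audited searches (refuter novelty
audit 2026-08-15: Guth1980, FrohlichSpencerCMP1982, FrohlichSpencerKT1981 = the classical engine;
PasturKhoruzhenko1987 = rotor order BY RP, so only the RP-free / time-continuum-uniform /
non-p-h-symmetric versions are open; LiebSeiringerSolovejYngvason2005 ch. 11 and AizenmanEtAl2004: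
half filling "dictated by our method of proof"). Physics of  [refs: 10.1007/s10955-016-1580-2, 1510.03215, 1708.00058, book:liebnd-statistical-mechanics, book:lieb2005-mathematics-bose-gas-its-condensation, doi:10.1007/s10955-016-1580-2, FriedliVelenik2017, BenassiLeesUeltschi2016, Guth1980, FrohlichSpencerCMP1982, FrohlichSpencerKT1981, PasturKhoruzhenko1987, LiebSeiringerSolovejYngvason2005, AizenmanEtAl2004, FisherLee1989, WallinEtAl1994, BalentsFisherNayak1998]

Barriers (technique_class: abelian-duality vortex-loop-Peierls worldline-currents): technique_class: abelian-duality vortex-loop-Peierls worldline-currents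
Literature.Barriers.HubbardSuperconductivity.PositiveTemperatureNoPairLRO: respected and used as the
template — crux SectorDWaveBKTBound claims only power-law quasi-LRO c(dist+1)^(-C/β) at each fixed β
< ∞ (the Koma–Tasaki upper bound has the same exponent shape ∝ 1/β; koma_tasaki_2d_holds is the
proved cone fact it saturates); T = 0 is reached only by β → ∞ at FIXED L (support
ThermalToGroundAverage), never by continuing an ordered phase from T > 0.
Literature.Barriers.HubbardSuperconductivity.HohenbergMerminWagnerPairing: same — no T > 0 LRO is
claimed; the T = 0 engine works in effective dimension 2+1 = 3 where vortex LOOPS (not points) are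
the defects and Peierls applies.
Literature.Barriers.HubbardSuperconductivity.LROForcesLowLyingStates: respected — `Thesis` is LRO of
U(1)-SYMMETRIC finite-volume sector states (⟨Δ†Δ⟩, not ⟨Δ⟩); the Anderson tower is the zero mode of
the dual height field; no uniform gap is claimed; the every-GS upgrade (AverageToEvery) is stated on
a U-window precisely because tower/accidental degeneracies are the failure mode.
Literature.Barriers.HubbardSuperconductivity.WeakCouplingCeiling: applies to crux
PairCurrentRepresentation if its first window is weak coupling (forming the pairing gap below
e^{-a/U}); NOT evaded — shared bet with route WeakCouplingBCS; this route concerns the scales BELOW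
the gap, where no expansion in U is made and the infrared problem is a positive-weig

History (route lifecycle, newest last):
- 2026-08-15T16:18:05Z · rev 2: restated AverageToEvery (stmt-HubbardSuperconductivity-1637) — route-repair (glue + cone): (1) deciding theorem `closes (hT : Thesis) (hA : AverageToEvery) : _root_.HubbardSuperconductivity` (4-line logic; the mechanical cl (planner-rbadge-HubbardSuperconductivity-Abelia-6c8815af-g2-0)
- 2026-08-15T16:22:01Z · rev 3: restated Assembly (stmt-HubbardSuperconductivity-1639) — route-repair (cone, step 2): purge `import Literature.Barriers.HubbardSuperconductivity.PureModelStripeCompetition` from the route file — it rode in on ITEM-LEV (planner-rbadge-HubbardSuperconductivity-Abelia-6c8815af-g2-0)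
- 2026-08-15T16:22:01Z · rev 3: dropped AverageToEvery — route-repair (cone, step 2): purge `import Literature.Barriers.HubbardSuperconductivity.PureModelStripeCompetition` from the route file — it rode in on ITEM-LEV (planner-rbadge-HubbardSuperconductivity-Abelia-6c8815af-g2-0)
- 2026-08-16T04:05:54Z · AUTO-CRUX (backfill): Thesis — hypotheses of the deciding theorem that nothing in the route derives are cruxes (operator:999:1085951)
- 2026-08-26T12:05:08Z · DORMANT — reconciler: no traction for 8.2 d (last activity item-evidence-added at 2026-08-18T06:56:25Z); parked, not closed — `ledger route dormant route-HubbardSupercond (operator:999:3912562)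

sub-problem: HubbardSuperconductivity · status: dormant · opened planner-plancard-HubbardSuperconductivity-Hub-6e88563f-0 2026-08-15T10:57:45Z · rev 3 · ledger route-HubbardSuperconductivity-AbelianDuality
GENERATED by the gate from the ledger (D-0016/17). Provers cite these decls: `theorem foo : Summit.HubbardSuperconductivity.HubbardSuperconductivity.Theses.AbelianDuality.<Decl> := …` in Summits/HubbardSuperconductivity/HubbardSuperconductivity/Theorems/<Name>.lean.
-/

namespace Summit.HubbardSuperconductivity.HubbardSuperconductivity.Theses.AbelianDuality

open scoped BigOperators Topology Manifold Classical MeasureTheory ProbabilityTheory Matrix InnerProductSpace ComplexConjugate ContinuousMap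
open Filter Set Function TopologicalSpace MeasureTheory

attribute [summit_statement] _root_.HubbardSuperconductivity

open Literature.Hubbard

/-- item stmt-HubbardSuperconductivity-1634 · crux (kind.auto-crux: conjecture-grade) · rank 0 · open · by planner
why it might fail: The pure t'=0 model may have no d-wave GS-average LRO on any open U-window at δ<1/2 (stripe/CDW competition, QinEtAl2020; weak-coupling order ~e^{-C/U²} is believed, RaghuKivelsonScalapino2010, not proved); a window (not one U) is demanded for the every-GS upgrade.
sources: Scalapino1995, KLS1988PRL, RaghuKivelsonScalapino2010, QinEtAl2020
[target] Sector-ground-state-AVERAGE d-wave pair LRO on a coupling window: ∃ δ∈(0,1/2), 0<U₁<U₂,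
c>0, L₀ such that for all U∈(U₁,U₂) and even L≥L₀, c·L⁴ ≤ Re ω₀^{sec}_{U,L}(Δ_d†Δ_d), where ω₀^{sec}
= Matrix.groundStateFunctional of hubbardTorus 2 L 1 U compressed (Matrix.toBlock p p) to the
coordinate sector p s := (|s| = N_L ∧ 2·#{↑∈s} = N_L), N_L = 2⌊(1-δ)L²/2⌋ — i.e. the uniform average
over the (N_L,S^z=0)-sector ground space (szSector N_L 0 is exactly this coordinate subspace:
IsNParticle + spinZ diagonal in the occupation basis). This is what every trace/world-line engine
(T=0 duality+Peierls; T>0 BKT bound + β→∞ at fixed L) delivers; the every-ground-state clause is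
crux AverageToEvery. Sources: Scalapino1995 §2 (order functional), KLS1988PRL (LRO of symmetric
finite-volume ground states), idea card abelian-duality-vortex-peierls. -/
@[route_item "route-HubbardSuperconductivity-AbelianDuality", crux]
def Thesis : Prop :=
  ∃ δ ∈ Set.Ioo (0:ℝ) (1/2), ∃ U₁ U₂ : ℝ, 0 < U₁ ∧ U₁ < U₂ ∧ ∃ c : ℝ, 0 < c ∧ ∃ L₀ : ℕ, ∀ U ∈ Set.Ioo U₁ U₂, ∀ (L : ℕ) [NeZero L], L₀ ≤ L → Even L → let p : Finset (Literature.MathematicalPhysics.QuantumLattice.Orb (Literature.MathematicalPhysics.QuantumLattice.FermionTorus 2 L)) → Prop := fun s => s.card = 2 * ⌊(1 - δ) * (L : ℝ) ^ 2 / 2⌋₊ ∧ 2 * (s.filter fun i => (ofLex i).2 = 0).card = 2 * ⌊(1 - δ) * (L : ℝ) ^ 2 / 2⌋₊; c * (L : ℝ) ^ 4 ≤ (((Literature.MathematicalPhysics.QuantumLattice.hubbardTorus 2 L 1 U).toBlock p p).groundStateFunctional (((Literature.MathematicalPhysics.QuantumLattice.pairField Literature.MathematicalPhysics.QuantumLattice.dWaveFormFactor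 L)ᴴ * Literature.MathematicalPhysics.QuantumLattice.pairField Literature.MathematicalPhysics.QuantumLattice.dWaveFormFactor L).toBlock p p)).re

-- item stmt-HubbardSuperconductivity-1786 · crux · rank 2 · open · by planner — informal only, no Lean statement yet:
--   [crux] (rank 2, hardest / most informative; informal until the definition PositiveCurrentModel lands
--   — def request filed `--for` this item) PAIR-CURRENT REDUCTION: there are δ ∈ (0,1/2), a window 0 <
--   U₁ < U₂, constants ρ₀, z₀, c > 0, β₀, L₀ and, for every U ∈ (U₁,U₂), even L ≥ L₀ and β ≥ β₀ (β = ∞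
--   allowed), a (2+1)-dimensional U(1) CLOSED-CURRENT MODEL J = J(U,L,β) on (ℤ/Lℤ)² × (imaginary-time
--   circle) with NON-NEGATIVE, translation-invariant, finite-range local weights whose Fourier duals are
--   non-negative (dual-positive / Villain class), phase stiffness ≥ ρ₀ and vortex fugacity ≤ z₀ — i.e. a
--   m

/-- item stmt-HubbardSuperconductivity-1635 · crux · rank 3 · open · by planner
why it might fail: Statement is physically safe; the risk is the ENGINE: spin-S world-line weights are positive but not dual-positive (non-Villain, box |m|≤S), so vortex-loop weights may be signed after Poisson resummation, and the Peierls bound must hold uniformly in the time-continuum limit.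
sources: KLS1988PRL, BenassiLeesUeltschi2016, FrohlichSpencerCMP1982, Guth1980, PasturKhoruzhenko1987, Tasaki2019Tower
[crux] ENGINE PROOF OF CONCEPT (Literature-grade, RP-inaccessible): for all large EVEN n (integer
spin S = n/2) the quantum XY FERROMAGNET H_L = -Σ_{u,v: torusDist u v = 1} (S¹_uS¹_v + S²_uS²_v) on
(ℤ/Lℤ)² with nearest AND next-nearest (ℓ∞-distance 1, 8 neighbours) couplings has ground-state LRO
along ALL sides L ≥ L₀: c·L⁴ ≤ Σ_{x,y} Re ω₀(S¹_xS¹_y + S²_xS²_y), ω₀ = Matrix.groundStateFunctional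
(tracial GS average). Chosen so that (a) the imaginary-time current representation is stoquastic
with INTEGER currents m ∈ {-S..S} and m ↦ -m symmetry (unfrustrated dual, no Berry phases), (b) S
large is the Peierls parameter (stiffness and vortex-core cost ∝ S², loop entropy O(1)), (c)
reflection positivity is unavailable (NNN bonds; odd L allowed) and BenassiLeesUeltschi2016 Cor. 2
gives monotonicity only in SAME-component couplings (opposite sign for the other component), so it
is NOT KLS1988PRL + correlation inequalities; PasturKhoruzhenko1987 (rotor order) is RP too.
Intended proof: duality of the (2+1)D closed-current model to an integer height/gauge model and
Peierls/energy–entropy on vortex LOOPS (Guth1980; FrohlichSpencerCMP1982, spin-system sections),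
uniform in the time-continuum -/
@[route_item "route-HubbardSuperconductivity-AbelianDuality"]
def LargeSpinKingXYLRO : Prop :=
  ∃ n₀ : ℕ, ∀ n : ℕ, n₀ ≤ n → Even n → ∃ c : ℝ, 0 < c ∧ ∃ L₀ : ℕ, ∀ (L : ℕ) [NeZero L], L₀ ≤ L → c * (L : ℝ) ^ 4 ≤ ∑ x : Literature.Probability.LatticeModels.TorusSite 2 L, ∑ y : Literature.Probability.LatticeModels.TorusSite 2 L, ((-(∑ u : Literature.Probability.LatticeModels.TorusSite 2 L, ∑ v : Literature.Probability.LatticeModels.TorusSite 2 L, if Literature.MathematicalPhysics.QuantumLattice.torusDist u v = 1 then (Literature.MathematicalPhysics.QuantumLattice.siteSpin n u 0 * Literature.MathematicalPhysics.QuantumLattice.siteSpin n v 0 + Literature.MathematicalPhysics.QuantumLattice.siteSpin n u 1 * Literature.MathematicalPhysics.QuantumLattice.siteSpin n v 1) else 0)).groundStateFunctional (Literature.MathematicalPhysics.QuantumLattice.siteSpin n x 0 * Literature.MathematicalPhysics.QuantumLattice.siteSpin n y 0 + Literature.MathematicalPhysics.QuantumLattice.siteSpin n x 1 * Literature.MathematicalPhysics.QuantumLattice.siteSpin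 n y 1)).re

/-- item stmt-HubbardSuperconductivity-1636 · crux · rank 4 · open · by planner
why it might fail: Needs a BKT pair phase of the pure t'=0 model on a whole U-window (T_BKT>0, stiffness ≥ρ₀) — contested numerically at moderate U; pointwise bound for dist≥R₀ must hold uniformly for β≫L; rigorous BKT lower bounds exist only for CLASSICAL XY/height models (FS81, arXiv:2110.09498).
sources: KomaTasakiPRL1992, FrohlichSpencerKT1981, 2110.09498, FrohlichSpencer1983BKT, QinEtAl2020
[crux] T>0 COMPANION saturating Koma–Tasaki: ∃ δ∈(0,1/2), window 0<U₁<U₂, β₀, c, C>0, R₀, L₀: for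
all U in the window, β ≥ β₀, even L ≥ L₀ and torus sites with torusDist x y ≥ R₀: c·(dist+1)^(-C/β)
≤ Re ⟨(P_x)ᴴ P_y⟩ in the CANONICAL (N_L,S^z=0)-sector Gibbs state Matrix.gibbsState β (H.toBlock p
p), P_x = localPair dWaveFormFactor L x. The proved cone fact koma_tasaki_2d
(PositiveTemperatureNoPairLRO_holds) is the matching UPPER bound C'(dist+1)^(-f(β)), f ∝ 1/β ('the
slowest possible decay is of KT type', KomaTasakiPRL1992 p.3); this crux is the LOWER bound of the
same shape, uniform in L INCLUDING β ≫ L (torus in its ground space), which is what support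
ThermalToGroundAverage needs to reach Thesis by β → ∞ at fixed L. Mechanism: the same abelian
duality one dimension down — height-function delocalisation / vortex energy–entropy for the slab
(FrohlichSpencerKT1981; arXiv:2110.09498 Aizenman–Harel–Peled–Shapiro) transplanted to the positive
pair-current model of crux PairCurrentRepresentation. R₀ excludes the short shell where normal-state
(Friedel) pair correlations, of size ≫ e^{-2C/U²} at weak coupling, can be negative. -/
@[route_item "route-HubbardSuperconductivity-AbelianDuality", crux]
def SectorDWaveBKTBound : Prop :=
  ∃ δ ∈ Set.Ioo (0:ℝ) (1/2), ∃ U₁ U₂ : ℝ, 0 < U₁ ∧ U₁ < U₂ ∧ ∃ β₀ c C : ℝ, 0 < β₀ ∧ 0 < c ∧ 0 < C ∧ ∃ R₀ L₀ : ℕ, ∀ U ∈ Set.Ioo U₁ U₂, ∀ β : ℝ, β₀ ≤ β → ∀ (L : ℕ) [NeZero L], L₀ ≤ L → Even L → ∀ x y : Literature.Probability.LatticeModels.TorusSite 2 L, R₀ ≤ Literature.MathematicalPhysics.QuantumLattice.torusDist x y → let p : Finset (Literature.MathematicalPhysics.QuantumLattice.Orb (Literature.MathematicalPhysics.QuantumLattice.FermionTorus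 2 L)) → Prop := fun s => s.card = 2 * ⌊(1 - δ) * (L : ℝ) ^ 2 / 2⌋₊ ∧ 2 * (s.filter fun i => (ofLex i).2 = 0).card = 2 * ⌊(1 - δ) * (L : ℝ) ^ 2 / 2⌋₊; c * ((Literature.MathematicalPhysics.QuantumLattice.torusDist x y : ℝ) + 1) ^ (-C / β) ≤ (Matrix.gibbsState β ((Literature.MathematicalPhysics.QuantumLattice.hubbardTorus 2 L 1 U).toBlock p p) (((Literature.MathematicalPhysics.QuantumLattice.localPair Literature.MathematicalPhysics.QuantumLattice.dWaveFormFactor L x)ᴴ * Literature.MathematicalPhysics.QuantumLattice.localPair Literature.MathematicalPhysics.QuantumLattice.dWaveFormFactor L y).toBlock p p)).re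

-- earlier AverageToEvery (stmt-HubbardSuperconductivity-1637, replaced 2026-08-15T16:18:05Z -> stmt-HubbardSuperconductivity-10519): retired by None — ∀ (δ U₁ U₂ c : ℝ) (L₀ : ℕ), 0 < U₁ → U₁ < U₂ → 0 < c → (∀ U ∈ Set.Ioo U₁ U₂, ∀ (L : ℕ) [NeZero L], L₀ ≤ L → Even L → let p : Finset (Literature.MathematicalPhysics.QuantumLattice.Orb (Literature.MathematicalPhysics.QuantumLattice.FermionTorus 2 L)) → 
/-- item stmt-HubbardSuperconductivity-10519 · crux · rank 5 · open · by planner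
why it might fail: Fails if sector ground spaces carry symmetry-unexplained multiplicity (accidental D₄/translation degeneracy) for ALL U of a window along infinitely many even L: average ≥cL⁴ is then compatible with one GS having o(L⁴) d-wave weight (KomaTasaki1994 Conj.10 direction is open).
sources: KomaTasaki1994, Tasaki2019Tower, Literature.Barriers.HubbardSuperconductivity.LROForcesLowLyingStates, KLS1988PRL, Lieb1989
[crux] EVERY-GROUND-STATE UPGRADE (card K3; shared concern of all S-side routes; cf. idea cards
generic-u-schur-every-gs, positivity-pins-characters, b1g-staircase-sector-characters): for all δ,
0<U₁<U₂, c>0, L₀ — if the sector-ground-state AVERAGE of Δ_d†Δ_d (Matrix.groundStateFunctional of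
hubbardTorus 2 L 1 U compressed to the (N_L,S^z=0) coordinate sector, N_L = 2⌊(1-δ)L²/2⌋) is ≥ c·L⁴
for every U in the window and every even L ≥ L₀, then at SOME U of the window EVERY normalised
(N_L,S^z=0)-sector ground-state sequence ψ_L (IsGroundStateInSector) has d_{x²-y²} pair-field LRO
along even sides: HasLongRangeOrder of torusPullback (pairFieldCorr dWaveFormFactor ψ) (2k) over
halfOpenBox 2 (2k) — the summit's body at fixed (U,δ) WRITTEN OUT. This conclusion is Iff.rfl-equal
to Literature.Barriers.HubbardSuperconductivity.HasDWavePairFieldLROAt U δ, the conclusion of the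
hub decl AverageToEvery of route AbelianDuality (stmt-HubbardSuperconductivity-1637, hypothesis
identical word for word); it is inlined here (route-repair 2026-08-15, planner Sketch.lean +
EquivCheck.lean rc 0) so that this route file no longer imports the Barriers module that registers
the open conjectures PureModelS -/
@[route_item "route-HubbardSuperconductivity-AbelianDuality", crux]
def AverageToEvery : Prop :=
  ∀ (δ U₁ U₂ c : ℝ) (L₀ : ℕ), 0 < U₁ → U₁ < U₂ → 0 < c → (∀ U ∈ Set.Ioo U₁ U₂, ∀ (L : ℕ) [NeZero L], L₀ ≤ L → Even L → let p : Finset (Literature.MathematicalPhysics.QuantumLattice.Orb (Literature.MathematicalPhysics.QuantumLattice.FermionTorus 2 L)) → Prop := fun s => s.card = 2 * ⌊(1 - δ) * (L : ℝ) ^ 2 / 2⌋₊ ∧ 2 * (s.filter fun i => (ofLex i).2 = 0).card = 2 * ⌊(1 - δ) * (L : ℝ) ^ 2 / 2⌋₊; c * (L : ℝ) ^ 4 ≤ (((Literature.MathematicalPhysics.QuantumLattice.hubbardTorus 2 L 1 U).toBlock p p).groundStateFunctional (((Literature.MathematicalPhysics.QuantumLattice.pairField Literature.MathematicalPhysics.QuantumLattice.dWaveFormFactor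 L)ᴴ * Literature.MathematicalPhysics.QuantumLattice.pairField Literature.MathematicalPhysics.QuantumLattice.dWaveFormFactor L).toBlock p p)).re) → ∃ U ∈ Set.Ioo U₁ U₂, ∀ (N : ℕ → ℕ) (ψ : ∀ L, Literature.MathematicalPhysics.QuantumLattice.Fock (Literature.MathematicalPhysics.QuantumLattice.Orb (Literature.MathematicalPhysics.QuantumLattice.FermionTorus 2 L))), (∀ L, Even L → N L = 2 * ⌊(1 - δ) * (L : ℝ) ^ 2 / 2⌋₊ ∧ star (ψ L) ⬝ᵥ ψ L = 1 ∧ Literature.MathematicalPhysics.QuantumLattice.IsGroundStateInSector (Literature.MathematicalPhysics.QuantumLattice.hubbardTorus 2 L 1 U) (N L) 0 (ψ L)) → Literature.Probability.LatticeModels.HasLongRangeOrder (fun k => Literature.Probability.LatticeModels.halfOpenBox 2 (2 * k)) (fun k => Literature.MathematicalPhysics.QuantumLattice.torusPullback (Literature.MathematicalPhysics.QuantumLattice.pairFieldCorr Literature.MathematicalPhysics.QuantumLattice.dWaveFormFactor ψ) (2 * k))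

/-- item stmt-HubbardSuperconductivity-1638 · support · rank 9 · closed · proved by Summit.HubbardSuperconductivity.HubbardSuperconductivity.Theorems.thermalToGroundAverage_proof (prover) · by planner
sources: Tasaki2020, KomaTasakiPRL1992
[support] GLUE, provable now: SectorDWaveBKTBound → Thesis. Proof sketch: keep δ and the window; fix
U and even L ≥ max(L₀, L₁). The compressed Hamiltonian H.toBlock p p is Hermitian and the sector is
non-empty, so Matrix.gibbsState β (H.toBlock p p) A → (H.toBlock p p).groundStateFunctional A as β →
∞ (tendsto_gibbsState_atTop_holds, PROVED in FinDimSpectrumGibbsLimitProofs). For torusDist x y ≥ R₀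
the hypothesis gives Re gibbs ≥ c(dist+1)^(-C/β) → c, hence Re ω₀ of the (P_x)ᴴP_y block is ≥ c; for
the ≤ (2R₀+1)²L² pairs with dist < R₀ use |ω₀(A)| ≤ ‖A‖ ≤ ‖P_x‖‖P_y‖ ≤ 32 (‖localPair
dWaveFormFactor‖ ≤ 4·2/√2). Linearity: (Δ_d†Δ_d).toBlock p p = Σ_{x,y} ((P_x)ᴴP_y).toBlock p p
(pairField = Σ_x localPair). Summing: Re ω₀ ≥ c(L⁴ - (2R₀+1)²L²) - 32(2R₀+1)²L² ≥ (c/2)L⁴ for L ≥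
L₁(c,R₀). Sources: Tasaki2020 App. A (Gibbs → ground-state functional), KomaTasakiPRL1992. -/
@[route_item "route-HubbardSuperconductivity-AbelianDuality"]
def ThermalToGroundAverage : Prop :=
  SectorDWaveBKTBound → Thesis

-- `ThermalToGroundAverage` holds: proved by `Summit.HubbardSuperconductivity.HubbardSuperconductivity.Theorems.thermalToGroundAverage_proof` (its module imports this route file, so no `_holds` link can be stated here).

-- earlier Assembly (stmt-HubbardSuperconductivity-1639, replaced 2026-08-15T16:22:01Z -> stmt-HubbardSuperconductivity-10723): retired by None — Thesis → AverageToEvery → HubbardSuperconductivity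
/-- item stmt-HubbardSuperconductivity-10723 · assembly · rank 1 · closed · proved by Summit.HubbardSuperconductivity.HubbardSuperconductivity.Theorems.abelianDuality_assembly_proof (prover) · by planner
sources: ArovasBergKivelsonRaghu2022, Scalapino1995
[assembly] Thesis → AverageToEvery → HubbardSuperconductivity: pure logic — literally the proof of
the route's DECIDING THEOREM `closes (hT : Thesis) (hA : AverageToEvery) :
_root_.HubbardSuperconductivity` (D-0027 §2.1, rendered below; elaborates, axioms
propext/Classical.choice/Quot.sound): obtain ⟨δ,hδ,U₁,U₂,hU₁,hU₁₂,c,hc,L₀,h⟩ := hT; obtain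
⟨U,hU,hLRO⟩ := hA δ U₁ U₂ c L₀ hU₁ hU₁₂ hc h; exact ⟨U, lt_trans hU₁ hU.1, δ, hδ, hLRO⟩ (the
conclusion of AverageToEvery is word for word the summit body at the produced (U, δ)). Candidate
proofs of exactly this term are attached as evidence on the earlier item
stmt-HubbardSuperconductivity-1639 (refuter route-review + grounder, 2026-08-15) and apply verbatim.
Restated 2026-08-15 by route-repair with the conclusion spelled `_root_.HubbardSuperconductivity`
(as in `closes`) for one reason only: the earlier wanted_by entry carried the item-level import
Literature.Barriers.HubbardSuperconductivity.PureModelStripeCompetition (needed by nothing in this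
file after AverageToEvery was inlined), which kept the two registered open conjectures
PureModelStripeCompetition{,Range} in the route's import cone; the assembly item cannot be dropped,
so it is -/
@[route_item "route-HubbardSuperconductivity-AbelianDuality"]
def Assembly : Prop :=
  Thesis → AverageToEvery → _root_.HubbardSuperconductivity

-- `Assembly` holds: proved by `Summit.HubbardSuperconductivity.HubbardSuperconductivity.Theorems.abelianDuality_assembly_proof` (its module imports this route file, so no `_holds` link can be stated here).

/-! D-0027 §2.1 — DECIDING THEOREM (planner-authored via `route open/edit --closes-file`; by planner-rbadge-HubbardSuperconductivity-Abelia-6c8815af-g2-0 2026-08-15T16:23:42Z):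
its hypotheses are this route's items and its conclusion the sub-problem Statement (glue_lint), and it elaborates with this file. -/

/-- DECIDING THEOREM (D-0027 §2.1). The route decides the sub-problem: the hub `Thesis`
(sector-ground-state-AVERAGE d-wave pair LRO on a coupling window, reached by either line of the
route) and the every-ground-state upgrade `AverageToEvery` give the summit statement — pure logic,
because the conclusion of `AverageToEvery` is word for word the body of
`Literature.Hubbard.DWaveSuperconductivityHubbard` at the produced `(U, δ)`, and `0 < U₁ < U`. -/
@[closes "route-HubbardSuperconductivity-AbelianDuality"] theorem closes (hT : Thesis) (hA : AverageToEvery) : _root_.HubbardSuperconductivity := by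
  obtain ⟨δ, hδ, U₁, U₂, hU₁, hU₁₂, c, hc, L₀, h⟩ := hT
  obtain ⟨U, hU, hLRO⟩ := hA δ U₁ U₂ c L₀ hU₁ hU₁₂ hc h
  exact ⟨U, lt_trans hU₁ hU.1, δ, hδ, hLRO⟩

end Summit.HubbardSuperconductivity.HubbardSuperconductivity.Theses.AbelianDuality
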